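import Mathlib
import Literature.Probability.Percolation.Percolation
import Literature.Probability.Percolation.DiagonalStripColumns
import Literature.Probability.Percolation.DiagonalColumnPatterns
import Literature.Probability.Percolation.DiagonalStripTransferExplicit
import Literature.Probability.Percolation.DiagonalStripTransferInhomogeneous
import Literature.Probability.Percolation.DiagonalStripTLAction
import Literature.Probability.Percolation.DiagonalStripTLActionFork
import Literature.Probability.Percolation.DiagonalStripTransferInterlacing
import Literature.Probability.Percolation.DiagonalStripTransferInterlacingTwoRow
import Literature.Probability.Percolation.DiagonalStripLumping
import Literature.Probability.LatticeModels.TemperleyLiebBaxterization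
import HarnessLib

/-!
# Ikhlef–Ponsaing's Lemma 3.2: the boundary reflections of `t(w; z⃗)` (cluster language)

Topic `Literature/Probability/Percolation`. Ikhlef–Ponsaing (J. Stat. Phys. 149 (2012),
arXiv:1202.5476) Lemma 3.2, second part: the double-row transfer matrix is invariant under
`z_1 → 1/z_1` and under `z_L → 1/z_L` (`L = 2m+1`). For `t = ipTransferMatrixW m q w z`
(`DiagonalStripTransferInhomogeneous.lean`) both reflections SWAP the weights of the two tiles of the
level in question between the two rows (`A(z/w) ↔ A(1/(wz))`), and the two-layer kernel is
insensitive to that swap for a combinatorial reason: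

* top (`z_L`): the top site of the odd column has exactly one lattice edge in each layer, so it is a
  pass-through of degree two: only "both edges open" matters (`ipTwoLayerW_top_congr`, via the
  single-edge tools `cpIsolate_colUpdate_setEdge`, `colUpdate_setEdge_of_singleton`,
  `colUpdate_cpIsolate_of_noEdge`); **`ipTransferMatrixW_reflect_top`**;
* bottom (`z_1`, the wall): the two level-`1` edges join the bottom odd site to the wall site of the
  even column on either side, i.e. they are parallel edges to the wall once flagged classes are
  lumped: only "both closed" matters (`ipTwoLayerW_bottom_congr`, via the absorption lemma
  `lump_patternOf_absorb` and `lump_colUpdate_setEdge_of_flag`,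
  `lump_colUpdate_colUpdate_setEdge_bottom`); **`ipTransferMatrixW_reflect_bottom`** (input flagged
  at the wall site, e.g. every valid even pattern).

Together with `DiagonalStripTransferInterlacingTwoRow.lean` this completes Lemma 3.2 for `t(w; z⃗)` in
the cluster language. (`[t(w), t(w')] = 0`, which IP12 cite to [DF05], is not here.)

## References

* Y. Ikhlef, A. K. Ponsaing, J. Stat. Phys. 149 (2012) 10–36, arXiv:1202.5476, Lemma 3.2.
  [IkhlefPonsaing2012]
-/

namespace Literature.Probability.Percolation

open Relation Literature.Probability.LatticeModels Literature.Probability.LatticeModels.TemperleyLieb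

variable {m : ℕ}

/-! ### Single-edge tools -/

section SingleEdge

variable {K : Type*} [Field K] {c : ℤ}

/-- **Detaching an old site with no edge does not change the update** (valid input). [folklore] -/
theorem colUpdate_cpIsolate_of_noEdge {P : ColPattern m} (hP : IsValid c P)
    {E : Fin (m + 1) → Fin (m + 1) → Bool} {v : Fin (m + 1)} (hE : ∀ j', E v j' = false) :
    colUpdate m c (cpIsolate v P) E = colUpdate m c P E := by
  rw [colUpdate_eq_patternOf, colUpdate_eq_patternOf]
  exact patternOf_congr' (fun x y => eqvGen_updRel_cpIsolate_inr_iff hP hE x (Sum.inr y) (by simp))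
    (fun x => exists_wall_cpIsolate_iff hP hE x)

/-- The update relation with one more edge is the old one plus that pair. [folklore] -/
theorem eqvGen_updRel_setEdge_true_iff (P : ColPattern m) (E : Fin (m + 1) → Fin (m + 1) → Bool)
    (i j : Fin (m + 1)) (x y : Fin (m + 1) ⊕ Fin (m + 1)) :
    EqvGen (updRel m P (setEdge E i j true)) x y ↔
      EqvGen (fun x y => updRel m P E x y ∨ (x = Sum.inl i ∧ y = Sum.inr j)) x y := by
  refine eqvGen_iff_eqvGen (fun x y h => ?_) (fun x y h => ?_) x y
  · rcases x with a | b <;> rcases y with a' | b' <;> simp only [updRel] at h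
    · exact EqvGen.rel _ _ (Or.inl h)
    · by_cases hab : a = i ∧ b' = j
      · exact EqvGen.rel _ _ (Or.inr ⟨by rw [hab.1], by rw [hab.2]⟩)
      · rw [setEdge_of_ne _ _ hab] at h; exact EqvGen.rel _ _ (Or.inl h)
    · by_cases hab : a' = i ∧ b = j
      · exact EqvGen.symm _ _ (EqvGen.rel _ _ (Or.inr ⟨by rw [hab.1], by rw [hab.2]⟩))
      · rw [setEdge_of_ne _ _ hab] at h; exact EqvGen.rel _ _ (Or.inl (show updRel m P E _ _ from h))
  · rcases h with h | ⟨rfl, rfl⟩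
    · rcases x with a | b <;> rcases y with a' | b' <;> simp only [updRel] at h
      · exact EqvGen.rel _ _ h
      · refine EqvGen.rel _ _ (show setEdge E i j true a b' = true from ?_)
        unfold setEdge; split_ifs; rfl; exact h
      · refine EqvGen.rel _ _ (show setEdge E i j true a' b = true from ?_)
        unfold setEdge; split_ifs; rfl; exact h
    · exact EqvGen.rel _ _ (show setEdge E i j true i j = true from setEdge_same E i j true)

/-- **Isolating the target of a single extra edge** at a new site `j` with no other edge and off the
wall: `iso_j (colUpdate P (E + (i,j))) = colUpdate P E`, and the same without the extra edge.
[folklore] -/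
theorem cpIsolate_colUpdate_setEdge {P : ColPattern m} {E : Fin (m + 1) → Fin (m + 1) → Bool}
    {j : Fin (m + 1)} (hE : ∀ i, E i j = false) (hWj : ¬ ((c + 1) % 2 = 0 ∧ (j : ℕ) = 0))
    (i : Fin (m + 1)) (b : Bool) :
    cpIsolate j (colUpdate m c P (setEdge E i j b)) = colUpdate m c P E := by
  classical
  rw [colUpdate_eq_patternOf, colUpdate_eq_patternOf]
  have hjs := updRel_isolated_of_noEdge hE P
  have hρ : Equivalence (EqvGen (updRel m P E)) := EqvGen.is_equivalence _
  set t : Fin (m + 1) ⊕ Fin (m + 1) := if b = true then Sum.inl i else Sum.inr j with ht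
  have hgen : ∀ x y, EqvGen (updRel m P (setEdge E i j b)) x y ↔
      EqvGen (fun x y => updRel m P E x y ∨ (x = t ∧ y = Sum.inr j)) x y := by
    intro x y
    cases b
    · rw [setEdge_eq_self (hE i)]
      simp only [ht, Bool.false_eq_true, if_false]
      refine eqvGen_iff_eqvGen (fun x y h => EqvGen.rel _ _ (Or.inl h)) (fun x y h => ?_) x y
      rcases h with h | ⟨rfl, rfl⟩
      · exact EqvGen.rel _ _ h
      · exact EqvGen.refl _
    · simp only [ht, if_true]
      exact eqvGen_updRel_setEdge_true_iff P E i j x y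
  refine cpIsolate_patternOf_pullback (t := t) hρ (fun x y => ?_) (fun y hy => ?_) hWj hWj
    (fun z hz => ⟨z, EqvGen.refl _, hz⟩) (fun z hz => ⟨z, EqvGen.refl _, hz⟩)
  · rw [hgen, eqvGen_attach_isolated t hjs]
  · exact (eqvGen_isolated_iff hjs y).1 hy

/-- **An extra edge from an unflagged singleton old site does not change the update.** [folklore] -/
theorem colUpdate_setEdge_of_singleton {P : ColPattern m} {E : Fin (m + 1) → Fin (m + 1) → Bool}
    {v : Fin (m + 1)} (hE : ∀ j', E v j' = false) (hv1 : ∀ x, P.1 v x = true → x = v)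
    (hv1' : ∀ x, P.1 x v = true → x = v) (hv2 : P.2 v = false) (j : Fin (m + 1)) :
    colUpdate m c P (setEdge E v j true) = colUpdate m c P E := by
  rw [colUpdate_eq_patternOf, colUpdate_eq_patternOf]
  -- `inl v` is a singleton class of the base closure
  have hiso : ∀ y, (updRel m P E (Sum.inl v) y → y = Sum.inl v) ∧ (updRel m P E y (Sum.inl v) → y = Sum.inl v) := by
    intro y
    rcases y with a | b
    · simp only [updRel, Sum.inl.injEq]
      exact ⟨fun h => (hv1 a h), fun h => hv1' a h⟩
    · simp [updRel, hE]
  have hsing : ∀ y, EqvGen (updRel m P E) (Sum.inl v) y ↔ y = Sum.inl v := eqvGen_isolated_iff' hiso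
  have hE' := EqvGen.is_equivalence (updRel m P E)
  have key : ∀ x y, EqvGen (updRel m P (setEdge E v j true)) (Sum.inr x) y ↔
      (EqvGen (updRel m P E) (Sum.inr x) y ∨ (y = Sum.inl v ∧ EqvGen (updRel m P E) (Sum.inr x) (Sum.inr j))) := by
    intro x y
    rw [eqvGen_updRel_setEdge_true_iff, eqvGen_insert_iff_mergeRel]
    simp only [mergeRel]
    constructor
    · rintro (h | ⟨h1, -⟩ | ⟨h1, h2⟩)
      · exact Or.inl h
      · exact absurd ((hsing _).1 (hE'.symm h1)) (by simp)
      · exact Or.inr ⟨(hsing _).1 h2, h1⟩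
    · rintro (h | ⟨rfl, h⟩)
      · exact Or.inl h
      · exact Or.inr (Or.inr ⟨h, hE'.refl _⟩)
  refine patternOf_congr' (fun x y => ?_) (fun x => ?_)
  · rw [key]
    constructor
    · rintro (h | ⟨h, -⟩)
      · exact h
      · simp at h
    · exact Or.inl
  · constructor
    · rintro ⟨z, hz, hw⟩
      rcases (key x z).1 hz with h | ⟨rfl, -⟩
      · exact ⟨z, h, hw⟩
      · simp [updWall, hv2] at hw
    · rintro ⟨z, hz, hw⟩
      exact ⟨z, (key x z).2 (Or.inl hz), hw⟩

/-- A new site with no edge is an unflagged singleton of the update (off the wall). [folklore] -/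
theorem colUpdate_singleton_of_noEdge (P : ColPattern m) {E : Fin (m + 1) → Fin (m + 1) → Bool}
    {j : Fin (m + 1)} (hE : ∀ i, E i j = false) (hWj : ¬ ((c + 1) % 2 = 0 ∧ (j : ℕ) = 0)) :
    (∀ x, (colUpdate m c P E).1 j x = true → x = j) ∧ (∀ x, (colUpdate m c P E).1 x j = true → x = j) ∧
      (colUpdate m c P E).2 j = false := by
  classical
  have hjs := updRel_isolated_of_noEdge hE P
  have hsing := eqvGen_isolated_iff hjs
  simp only [colUpdate, decide_eq_true_eq, decide_eq_false_iff_not, not_exists, not_and]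
  refine ⟨fun x h => Sum.inr_injective ((hsing _).1 h) |>.symm ▸ rfl, fun x h => ?_, fun z hz hw => ?_⟩
  · have := (hsing _).1 (EqvGen.symm _ _ h)
    exact Sum.inr_injective this
  · have := (hsing _).1 hz
    subst this
    exact hWj (by simpa [updWall] using hw)

/-- **Splitting off one edge** of a weighted layer sum. [folklore] -/
theorem sum_powerset_edge_decomp {e : Sym2 (Site 2)} (he : e ∈ latticeLayer m c)
    (p : Sym2 (Site 2) → K) (Φ : Finset (Sym2 (Site 2)) → K) :
    ∑ U ∈ (latticeLayer m c).powerset, Φ U * ((∏ e ∈ U, p e) * ∏ e ∈ latticeLayer m c \ U, (1 - p e)) =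
      ∑ t ∈ ((latticeLayer m c).erase e).powerset,
        ((∏ e ∈ t, p e) * ∏ e ∈ ((latticeLayer m c).erase e) \ t, (1 - p e)) *
          (Φ (insert e t) * p e + Φ t * (1 - p e)) := by
  set rest := (latticeLayer m c).erase e with hrest
  have herest : e ∉ rest := Finset.notMem_erase _ _
  have hlayer : latticeLayer m c = insert e rest := by rw [hrest, Finset.insert_erase he]
  rw [hlayer, Finset.sum_powerset_insert (β := K) herest, ← Finset.sum_add_distrib]
  refine Finset.sum_congr rfl fun t ht => ?_
  have hts : t ⊆ rest := Finset.mem_powerset.1 ht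
  have het : e ∉ t := fun h => herest (hts h)
  have s1 : insert e rest \ insert e t = rest \ t := by
    ext x
    simp only [Finset.mem_sdiff, Finset.mem_insert, not_or]
    constructor
    · rintro ⟨h1 | h1, h2, h3⟩
      · exact absurd h1 h2
      · exact ⟨h1, h3⟩
    · rintro ⟨h1, h2⟩
      exact ⟨Or.inr h1, fun h => herest (h ▸ h1), h2⟩
  have s2 : insert e rest \ t = insert e (rest \ t) := by
    ext x
    simp only [Finset.mem_sdiff, Finset.mem_insert]
    constructor
    · rintro ⟨h1 | h1, h2⟩
      · exact Or.inl h1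
      · exact Or.inr ⟨h1, h2⟩
    · rintro (rfl | ⟨h1, h2⟩)
      · exact ⟨Or.inl rfl, het⟩
      · exact ⟨Or.inr h1, h2⟩
  have hert : e ∉ rest \ t := fun h => herest (Finset.mem_sdiff.1 h).1
  rw [s1, s2, Finset.prod_insert het, Finset.prod_insert hert]
  ring

end SingleEdge

/-! ### The top boundary reflection `z_L → 1/z_L` -/

section Top

variable {K : Type*} [Field K]

/-- The two-layer kernel as a double sum over the edge sets of the two layers. [folklore] -/
theorem ipTwoLayerW_eq_sum_sum (p₀ p₁ : Sym2 (Site 2) → K) (Q Q' : ColPattern m) :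
    ipTwoLayerW m p₀ p₁ Q Q' = ∑ U₀ ∈ (latticeLayer m 0).powerset,
      (∑ U₁ ∈ (latticeLayer m 1).powerset,
        (if lump (colUpdate m 1 (colUpdate m 0 Q (edgeFn m 0 U₀)) (edgeFn m 1 U₁)) = Q' then (1 : K) else 0) *
          ((∏ e ∈ U₁, p₁ e) * ∏ e ∈ latticeLayer m 1 \ U₁, (1 - p₁ e))) *
      ((∏ e ∈ U₀, p₀ e) * ∏ e ∈ latticeLayer m 0 \ U₀, (1 - p₀ e)) := by
  unfold ipTwoLayerW
  have h1 : ∀ P₁ : ColPattern m,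
      (∑ P₂ ∈ Finset.univ.filter (fun P₂ : ColPattern m => lump P₂ = Q'),
        ipTransferW m 0 p₀ Q P₁ * ipTransferW m 1 p₁ P₁ P₂) =
      ipTransferW m 0 p₀ Q P₁ * ∑ U₁ ∈ (latticeLayer m 1).powerset,
        (if lump (colUpdate m 1 P₁ (edgeFn m 1 U₁)) = Q' then (1 : K) else 0) *
          ((∏ e ∈ U₁, p₁ e) * ∏ e ∈ latticeLayer m 1 \ U₁, (1 - p₁ e)) := fun P₁ => by
    rw [← Finset.mul_sum, sum_filter_ipTransferW_eq 1 p₁ P₁ Q' lump]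
  simp_rw [h1]
  unfold ipTransferW
  simp_rw [Finset.sum_mul, ite_mul, zero_mul]
  rw [Finset.sum_comm]
  refine Finset.sum_congr rfl fun U₀ _ => ?_
  rw [Finset.sum_ite_eq]
  simp only [Finset.mem_univ, if_true]
  rw [Finset.mul_sum]
  refine Finset.sum_congr rfl fun U₁ _ => ?_
  split_ifs <;> ring

/-- **The two-layer kernel only sees the product of the weights of the two top edges.** If two pairs
of row weights agree except on the top edge of each layer (the two edges at the top site of the odd
column, a site of degree two) and the products of the two top weights agree, the lumped two-layer
kernels agree (any input). This is the mechanism of the reflection `z_L → 1/z_L` of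
Ikhlef–Ponsaing's Lemma 3.2. [cite: IkhlefPonsaing2012, Lemma 3.2] -/
theorem ipTwoLayerW_top_congr {p₀ p₁ p₀' p₁' : Sym2 (Site 2) → K}
    (h₀ : ∀ e ∈ latticeLayer m 0, e ≠ s(colSite 0 ((Fin.last m : Fin (m + 1)) : ℕ),
      colSite (0 + 1) ((Fin.last m : Fin (m + 1)) : ℕ)) → p₀' e = p₀ e)
    (h₁ : ∀ e ∈ latticeLayer m 1, e ≠ s(colSite 1 ((Fin.last m : Fin (m + 1)) : ℕ),
      colSite (1 + 1) ((Fin.last m : Fin (m + 1)) : ℕ)) → p₁' e = p₁ e)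
    (hswap : p₀' s(colSite 0 ((Fin.last m : Fin (m + 1)) : ℕ), colSite (0 + 1) ((Fin.last m : Fin (m + 1)) : ℕ)) *
        p₁' s(colSite 1 ((Fin.last m : Fin (m + 1)) : ℕ), colSite (1 + 1) ((Fin.last m : Fin (m + 1)) : ℕ)) =
      p₀ s(colSite 0 ((Fin.last m : Fin (m + 1)) : ℕ), colSite (0 + 1) ((Fin.last m : Fin (m + 1)) : ℕ)) *
        p₁ s(colSite 1 ((Fin.last m : Fin (m + 1)) : ℕ), colSite (1 + 1) ((Fin.last m : Fin (m + 1)) : ℕ)))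
    (Q Q' : ColPattern m) :
    ipTwoLayerW m p₀ p₁ Q Q' = ipTwoLayerW m p₀' p₁' Q Q' := by
  set l : Fin (m + 1) := Fin.last m with hl
  set e₀ := s(colSite 0 (l : ℕ), colSite (0 + 1) (l : ℕ)) with he₀
  set e₁ := s(colSite 1 (l : ℕ), colSite (1 + 1) (l : ℕ)) with he₁
  have hl' : (l : ℕ) = m := by simp [hl]
  have he₀mem : e₀ ∈ latticeLayer m 0 := (mk_mem_latticeLayer_iff 0 l l).2 (Or.inl rfl)
  have he₁mem : e₁ ∈ latticeLayer m 1 := (mk_mem_latticeLayer_iff 1 l l).2 (Or.inl rfl)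
  -- the only layer-0 edge at the new site `l` and the only layer-1 edge at the old site `l`
  have honly₀ : ∀ i : Fin (m + 1), s(colSite 0 (i : ℕ), colSite (0 + 1) (l : ℕ)) ∈ latticeLayer m 0 → i = l :=
    fun i hi => by
      rcases (mk_mem_latticeLayer_iff 0 i l).1 hi with h | h
      · exact Fin.ext (by omega)
      · exfalso; have := i.isLt; omega
  have honly₁ : ∀ j' : Fin (m + 1), s(colSite 1 (l : ℕ), colSite (1 + 1) (j' : ℕ)) ∈ latticeLayer m 1 → j' = l :=
    fun j' hj' => by
      rcases (mk_mem_latticeLayer_iff 1 l j').1 hj' with h | h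
      · exact Fin.ext (by omega)
      · exfalso; have := j'.isLt; omega
  have hno₀ : ∀ t ⊆ (latticeLayer m 0).erase e₀, ∀ i : Fin (m + 1), edgeFn m 0 t i l = false := by
    intro t ht i
    simp only [edgeFn, decide_eq_false_iff_not]
    intro hmem
    have h' := ht hmem
    have := honly₀ i (Finset.mem_of_mem_erase h')
    subst this
    exact (Finset.mem_erase.1 h').1 rfl
  have hno₁ : ∀ t ⊆ (latticeLayer m 1).erase e₁, ∀ j' : Fin (m + 1), edgeFn m 1 t l j' = false := by
    intro t ht j'
    simp only [edgeFn, decide_eq_false_iff_not]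
    intro hmem
    have h' := ht hmem
    have := honly₁ j' (Finset.mem_of_mem_erase h')
    subst this
    exact (Finset.mem_erase.1 h').1 rfl
  have hW : ¬ (((0 : ℤ) + 1) % 2 = 0 ∧ ((l : Fin (m + 1)) : ℕ) = 0) := by omega
  rw [ipTwoLayerW_eq_sum_sum, ipTwoLayerW_eq_sum_sum,
    sum_powerset_edge_decomp he₀mem p₀, sum_powerset_edge_decomp he₀mem p₀']
  refine Finset.sum_congr rfl fun t₀ ht₀ => ?_
  have ht₀s : t₀ ⊆ (latticeLayer m 0).erase e₀ := Finset.mem_powerset.1 ht₀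
  -- rest weights of layer 0 agree
  have hw₀ : ((∏ e ∈ t₀, p₀' e) * ∏ e ∈ (latticeLayer m 0).erase e₀ \ t₀, (1 - p₀' e)) =
      (∏ e ∈ t₀, p₀ e) * ∏ e ∈ (latticeLayer m 0).erase e₀ \ t₀, (1 - p₀ e) := by
    have h1 : ∏ e ∈ t₀, p₀' e = ∏ e ∈ t₀, p₀ e := Finset.prod_congr rfl fun e he =>
      h₀ e (Finset.mem_of_mem_erase (ht₀s he)) (Finset.mem_erase.1 (ht₀s he)).1
    have h2 : ∏ e ∈ (latticeLayer m 0).erase e₀ \ t₀, (1 - p₀' e) =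
        ∏ e ∈ (latticeLayer m 0).erase e₀ \ t₀, (1 - p₀ e) := Finset.prod_congr rfl fun e he => by
      rw [h₀ e (Finset.mem_of_mem_erase (Finset.sdiff_subset he)) (Finset.mem_erase.1 (Finset.sdiff_subset he)).1]
    rw [h1, h2]
  rw [hw₀]
  rw [sum_powerset_edge_decomp he₁mem p₁, sum_powerset_edge_decomp he₁mem p₁,
    sum_powerset_edge_decomp he₁mem p₁', sum_powerset_edge_decomp he₁mem p₁']
  rw [Finset.sum_mul, Finset.sum_mul, Finset.sum_mul, Finset.sum_mul, ← Finset.sum_add_distrib,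
    ← Finset.sum_add_distrib, Finset.mul_sum, Finset.mul_sum]
  refine Finset.sum_congr rfl fun t₁ ht₁ => ?_
  have ht₁s : t₁ ⊆ (latticeLayer m 1).erase e₁ := Finset.mem_powerset.1 ht₁
  have hw₁ : ((∏ e ∈ t₁, p₁' e) * ∏ e ∈ (latticeLayer m 1).erase e₁ \ t₁, (1 - p₁' e)) =
      (∏ e ∈ t₁, p₁ e) * ∏ e ∈ (latticeLayer m 1).erase e₁ \ t₁, (1 - p₁ e) := by
    have h1 : ∏ e ∈ t₁, p₁' e = ∏ e ∈ t₁, p₁ e := Finset.prod_congr rfl fun e he =>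
      h₁ e (Finset.mem_of_mem_erase (ht₁s he)) (Finset.mem_erase.1 (ht₁s he)).1
    have h2 : ∏ e ∈ (latticeLayer m 1).erase e₁ \ t₁, (1 - p₁' e) =
        ∏ e ∈ (latticeLayer m 1).erase e₁ \ t₁, (1 - p₁ e) := Finset.prod_congr rfl fun e he => by
      rw [h₁ e (Finset.mem_of_mem_erase (Finset.sdiff_subset he)) (Finset.mem_erase.1 (Finset.sdiff_subset he)).1]
    rw [h1, h2]
  rw [hw₁]
  -- the three dead-end configurations give the same pattern
  have hins₀ : edgeFn m 0 (insert e₀ t₀) = setEdge (edgeFn m 0 t₀) l l true := by rw [he₀, edgeFn_insert]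
  have hins₁ : edgeFn m 1 (insert e₁ t₁) = setEdge (edgeFn m 1 t₁) l l true := by rw [he₁, edgeFn_insert]
  have F1 : colUpdate m 1 (colUpdate m 0 Q (edgeFn m 0 (insert e₀ t₀))) (edgeFn m 1 t₁) =
      colUpdate m 1 (colUpdate m 0 Q (edgeFn m 0 t₀)) (edgeFn m 1 t₁) := by
    have hV := colUpdate_isValid (m := m) 0 Q (edgeFn m 0 (insert e₀ t₀))
    norm_num at hV
    rw [← colUpdate_cpIsolate_of_noEdge hV (hno₁ t₁ ht₁s), hins₀,
      cpIsolate_colUpdate_setEdge (hno₀ t₀ ht₀s) hW]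
  have F2 : colUpdate m 1 (colUpdate m 0 Q (edgeFn m 0 t₀)) (edgeFn m 1 (insert e₁ t₁)) =
      colUpdate m 1 (colUpdate m 0 Q (edgeFn m 0 t₀)) (edgeFn m 1 t₁) := by
    obtain ⟨s1, s2, s3⟩ := colUpdate_singleton_of_noEdge (c := 0) Q (hno₀ t₀ ht₀s) hW
    rw [hins₁, colUpdate_setEdge_of_singleton (hno₁ t₁ ht₁s) s1 s2 s3]
  rw [F1, F2]
  linear_combination ((∏ e ∈ t₀, p₀ e) * ∏ e ∈ (latticeLayer m 0).erase e₀ \ t₀, (1 - p₀ e)) *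
    ((∏ e ∈ t₁, p₁ e) * ∏ e ∈ (latticeLayer m 1).erase e₁ \ t₁, (1 - p₁ e)) *
    ((if lump (colUpdate m 1 (colUpdate m 0 Q (edgeFn m 0 t₀)) (edgeFn m 1 t₁)) = Q' then (1 : K) else 0) -
      (if lump (colUpdate m 1 (colUpdate m 0 Q (edgeFn m 0 (insert e₀ t₀))) (edgeFn m 1 (insert e₁ t₁))) = Q'
        then (1 : K) else 0)) * hswap

end Top

section TopReflect

variable {K : Type*} [Field K]

/-- Row weights only see the rapidity at the top level of the edge. [folklore] -/
theorem ipRowWeight_congr_level (q w : K) {z z' : ℕ → K} (r : Fin 2) {e : Sym2 (Site 2)}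
    (h : z' (edgeTopLevel e).toNat = z (edgeTopLevel e).toNat) :
    ipRowWeight q w z' r e = ipRowWeight q w z r e := by
  unfold ipRowWeight; rw [h]

/-- **Ikhlef–Ponsaing's Lemma 3.2, top reflection: `t(w; z_1, …, 1/z_L) = t(w; z_1, …, z_L)`**
(`L = 2m+1`), in the cluster language. [cite: IkhlefPonsaing2012, Lemma 3.2] -/
theorem ipTransferMatrixW_reflect_top (q w : K) (z : ℕ → K) (Q Q' : ColPattern m) :
    ipTransferMatrixW m q w (Function.update z (2 * m + 1) (z (2 * m + 1))⁻¹) Q Q' =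
      ipTransferMatrixW m q w z Q Q' := by
  rw [ipTransferMatrixW_eq, ipTransferMatrixW_eq]
  symm
  have hl : ((Fin.last m : Fin (m + 1)) : ℕ) = m := by simp
  have hlev₀ : (edgeTopLevel s(colSite 0 ((Fin.last m : Fin (m + 1)) : ℕ),
      colSite (0 + 1) ((Fin.last m : Fin (m + 1)) : ℕ))).toNat = 2 * m + 1 := by
    rw [edgeTopLevel_mk_colSite]; omega
  have hlev₁ : (edgeTopLevel s(colSite 1 ((Fin.last m : Fin (m + 1)) : ℕ),
      colSite (1 + 1) ((Fin.last m : Fin (m + 1)) : ℕ))).toNat = 2 * m + 1 := by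
    rw [edgeTopLevel_mk_colSite]; omega
  have hmem₀ : s(colSite 0 ((Fin.last m : Fin (m + 1)) : ℕ), colSite (0 + 1) ((Fin.last m : Fin (m + 1)) : ℕ)) ∈
      latticeLayer m 0 := (mk_mem_latticeLayer_iff 0 _ _).2 (Or.inl rfl)
  have hmem₁ : s(colSite 1 ((Fin.last m : Fin (m + 1)) : ℕ), colSite (1 + 1) ((Fin.last m : Fin (m + 1)) : ℕ)) ∈
      latticeLayer m 1 := (mk_mem_latticeLayer_iff 1 _ _).2 (Or.inl rfl)
  refine ipTwoLayerW_top_congr (fun e he hne => ?_) (fun e he hne => ?_) ?_ Q Q'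
  · refine ipRowWeight_congr_level q w 0 (Function.update_of_ne (fun h => hne ?_) _ _)
    exact eq_of_edgeTopLevel_eq he hmem₀ (by omega)
  · refine ipRowWeight_congr_level q w 1 (Function.update_of_ne (fun h => hne ?_) _ _)
    exact eq_of_edgeTopLevel_eq he hmem₁ (by omega)
  · rw [ipRowWeight_eq_of_level q w _ 0 hlev₀, ipRowWeight_eq_of_level q w _ 1 hlev₁,
      ipRowWeight_eq_of_level q w _ 0 hlev₀, ipRowWeight_eq_of_level q w _ 1 hlev₁]
    have h10 : (1 : Fin 2) ≠ 0 := by decide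
    have hodd : (2 * m + 1) % 2 = 1 := by omega
    simp only [hodd, if_true, h10, if_false, Function.update_self]
    have e1 : (z (2 * m + 1))⁻¹ / w = (w * z (2 * m + 1))⁻¹ := by rw [div_eq_mul_inv, mul_inv, mul_comm]
    have e2 : (w * (z (2 * m + 1))⁻¹)⁻¹ = z (2 * m + 1) / w := by
      rw [mul_inv, inv_inv, div_eq_mul_inv, mul_comm]
    rw [e1, e2, mul_comm]

end TopReflect

/-! ### The bottom boundary reflection `z_1 → 1/z_1` (the wall) -/

section Absorb

/-- **Lumping absorbs merges of wall-connected classes.** If `ρ ≤ ρ'`, `ρ'` is generated by pairs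
that are either in `ρ` or join two `ρ`-wall-reachable points, and the extra wall contacts of `W'`
are `ρ`-wall-reachable, then the lumped patterns read off `(ρ', W')` and `(ρ, W)` agree. [folklore] -/
theorem lump_patternOf_absorb {ρ ρ' g' : Fin (m + 1) ⊕ Fin (m + 1) → Fin (m + 1) ⊕ Fin (m + 1) → Prop}
    {W W' : Fin (m + 1) ⊕ Fin (m + 1) → Prop} (hρ : Equivalence ρ) (hle : ∀ x y, ρ x y → ρ' x y)
    (hρ' : ∀ x y, ρ' x y ↔ EqvGen g' x y)
    (hg' : ∀ x y, g' x y → ρ x y ∨ ((∃ z, ρ x z ∧ W z) ∧ (∃ z, ρ y z ∧ W z)))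
    (hW : ∀ z, W z → W' z) (hW' : ∀ z, W' z → W z ∨ ∃ z', ρ z z' ∧ W z') :
    lump (patternOf ρ' W') = lump (patternOf ρ W) := by
  classical
  -- `R x`: `x` reaches the wall in `ρ`; it is `ρ`-saturated
  set R : Fin (m + 1) ⊕ Fin (m + 1) → Prop := fun x => ∃ z, ρ x z ∧ W z with hR
  have Rsat : ∀ x y, ρ x y → R y → R x := fun x y hxy ⟨z, hyz, hz⟩ => ⟨z, hρ.trans hxy hyz, hz⟩
  -- claim 1: `ρ' ≤ ρ ∨ (R × R)`
  have claim1 : ∀ x y, ρ' x y → ρ x y ∨ (R x ∧ R y) := by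
    intro x y h
    rw [hρ'] at h
    induction h with
    | rel x y h => exact hg' x y h
    | refl x => exact Or.inl (hρ.refl x)
    | symm x y _ ih => exact ih.elim (fun h => Or.inl (hρ.symm h)) fun h => Or.inr ⟨h.2, h.1⟩
    | trans x y z _ _ ih1 ih2 =>
      rcases ih1 with h1 | ⟨h1, h1'⟩ <;> rcases ih2 with h2 | ⟨h2, h2'⟩
      · exact Or.inl (hρ.trans h1 h2)
      · exact Or.inr ⟨Rsat x y h1 h2, h2'⟩
      · exact Or.inr ⟨h1, Rsat z y (hρ.symm h2) h1'⟩
      · exact Or.inr ⟨h1, h2'⟩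
  -- claim 2: wall-reachability is the same
  have claim2 : ∀ x, (∃ z, ρ' x z ∧ W' z) ↔ R x := by
    intro x
    constructor
    · rintro ⟨z, hxz, hz⟩
      rcases claim1 x z hxz with h | ⟨h, -⟩
      · rcases hW' z hz with hz' | hz'
        · exact ⟨z, h, hz'⟩
        · exact Rsat x z h hz'
      · exact h
    · rintro ⟨z, hxz, hz⟩
      exact ⟨z, hle x z hxz, hW z hz⟩
  refine Prod.ext (funext fun x => funext fun y => ?_) (funext fun x => ?_)
  · rw [Bool.eq_iff_iff, lump_fst_eq_true_iff, lump_fst_eq_true_iff]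
    simp only [patternOf, decide_eq_true_eq]
    rw [claim2, claim2]
    constructor
    · rintro (h | h)
      · exact claim1 _ _ h
      · exact Or.inr h
    · rintro (h | h)
      · exact Or.inl (hle _ _ h)
      · exact Or.inr h
  · simp only [lump_snd, patternOf]
    rw [decide_eq_decide]
    exact claim2 _

end Absorb

section Bottom

variable {K : Type*} [Field K]

/-- **An extra edge between a flagged old site and the wall site of the new (even) column is
absorbed by lumping.** [folklore] -/
theorem lump_colUpdate_setEdge_of_flag {c : ℤ} {P : ColPattern m} {E : Fin (m + 1) → Fin (m + 1) → Bool}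
    {v j : Fin (m + 1)} (hv : P.2 v = true) (hj : (c + 1) % 2 = 0 ∧ (j : ℕ) = 0) :
    lump (colUpdate m c P (setEdge E v j true)) = lump (colUpdate m c P E) := by
  rw [colUpdate_eq_patternOf, colUpdate_eq_patternOf]
  have hρ := EqvGen.is_equivalence (updRel m P E)
  refine lump_patternOf_absorb (g' := updRel m P (setEdge E v j true)) hρ (fun x y h => ?_)
    (fun x y => Iff.rfl) (fun x y h => ?_) (fun z hz => hz) (fun z hz => Or.inl hz)
  · refine eqvGen_le_eqvGen (fun x y h => EqvGen.rel _ _ (updRel_mono_edges (fun i j' h => ?_) P x y h)) x y h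
    unfold setEdge; split_ifs; rfl; exact h
  · have hvR : ∃ z, EqvGen (updRel m P E) (Sum.inl v) z ∧ updWall m c P z :=
      ⟨Sum.inl v, EqvGen.refl _, hv⟩
    have hjR : ∃ z, EqvGen (updRel m P E) (Sum.inr j) z ∧ updWall m c P z :=
      ⟨Sum.inr j, EqvGen.refl _, hj⟩
    rcases x with a | b <;> rcases y with a' | b' <;> simp only [updRel] at h
    · exact Or.inl (EqvGen.rel _ _ h)
    · by_cases hab : a = v ∧ b' = j
      · rw [hab.1, hab.2]; exact Or.inr ⟨hvR, hjR⟩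
      · rw [setEdge_of_ne _ _ hab] at h; exact Or.inl (EqvGen.rel (Sum.inl a) (Sum.inr b') h)
    · by_cases hab : a' = v ∧ b = j
      · rw [hab.1, hab.2]; exact Or.inr ⟨hjR, hvR⟩
      · rw [setEdge_of_ne _ _ hab] at h; exact Or.inl (EqvGen.rel (Sum.inr b) (Sum.inl a') h)

/-- **Attaching the bottom odd site to the wall in the first layer is absorbed after the second
layer attaches it to the wall of the next even column.** With `P₁¹ = colUpdate 0 Q (E₀ + (0,0))`,
`P₁⁰ = colUpdate 0 Q E₀` (`Q` flagged at the wall site) and a second layer `E₁'` containing the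
edge `(0,0)` to the wall site of column `2`: `lump (colUpdate 1 P₁¹ E₁') = lump (colUpdate 1 P₁⁰ E₁')`.
[folklore] -/
theorem lump_colUpdate_colUpdate_setEdge_bottom {Q : ColPattern m} (hQ0 : Q.2 0 = true)
    (E₀ : Fin (m + 1) → Fin (m + 1) → Bool) {E₁' : Fin (m + 1) → Fin (m + 1) → Bool} (hE₁ : E₁' 0 0 = true) :
    lump (colUpdate m 1 (colUpdate m 0 Q (setEdge E₀ 0 0 true)) E₁') =
      lump (colUpdate m 1 (colUpdate m 0 Q E₀) E₁') := by
  classical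
  -- layer 0: the closure with the extra edge is `mergeRel` of the one without
  set ρ₀ := EqvGen (updRel m Q E₀) with hρ₀
  have hE0 := EqvGen.is_equivalence (updRel m Q E₀)
  have hρ₀' : ∀ x y, EqvGen (updRel m Q (setEdge E₀ 0 0 true)) x y ↔ mergeRel ρ₀ (Sum.inl 0) (Sum.inr 0) x y :=
    fun x y => by rw [eqvGen_updRel_setEdge_true_iff, eqvGen_insert_iff_mergeRel]
  set P₁ := colUpdate m 0 Q E₀ with hP₁
  set P₁' := colUpdate m 0 Q (setEdge E₀ 0 0 true) with hP₁'
  -- entries of the two first-layer outputs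
  have hrel : ∀ a b, P₁.1 a b = true ↔ ρ₀ (Sum.inr a) (Sum.inr b) := fun a b => by
    simp only [hP₁, colUpdate, decide_eq_true_eq, hρ₀]
  have hflag : ∀ a, P₁.2 a = true ↔ ∃ z, ρ₀ (Sum.inr a) z ∧ updWall m 0 Q z := fun a => by
    simp only [hP₁, colUpdate, decide_eq_true_eq, hρ₀]
  have hrel' : ∀ a b, P₁'.1 a b = true ↔ mergeRel ρ₀ (Sum.inl 0) (Sum.inr 0) (Sum.inr a) (Sum.inr b) :=
    fun a b => by simp only [hP₁', colUpdate, decide_eq_true_eq]; exact hρ₀' _ _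
  have hflag' : ∀ a, P₁'.2 a = true ↔ ∃ z, mergeRel ρ₀ (Sum.inl 0) (Sum.inr 0) (Sum.inr a) z ∧ updWall m 0 Q z :=
    fun a => by
      simp only [hP₁', colUpdate, decide_eq_true_eq]
      exact exists_congr fun z => and_congr (hρ₀' _ _) Iff.rfl
  have hW0 : updWall m 0 Q (Sum.inl 0) := hQ0
  -- odd sites attached to the wall class are flagged in `P₁`
  have flagA : ∀ a, ρ₀ (Sum.inr a) (Sum.inl 0) → P₁.2 a = true := fun a h => (hflag a).2 ⟨_, h, hW0⟩
  -- layer 1 data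
  rw [colUpdate_eq_patternOf, colUpdate_eq_patternOf]
  set ρ := EqvGen (updRel m P₁ E₁') with hρ
  have hE := EqvGen.is_equivalence (updRel m P₁ E₁')
  have hW1 : updWall m 1 P₁ (Sum.inr 0) := by simp [updWall]
  -- `inl b` reaches the wall of column 2 when `b` is in the class of the bottom odd site
  have reachB : ∀ b, ρ₀ (Sum.inr 0) (Sum.inr b) → ∃ z, ρ (Sum.inl b) z ∧ updWall m 1 P₁ z := fun b h =>
    ⟨Sum.inr 0, EqvGen.trans _ _ _ (EqvGen.rel (Sum.inl b) (Sum.inl 0) ((hrel b 0).2 (hE0.symm h)))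
      (EqvGen.rel (Sum.inl 0) (Sum.inr 0) hE₁), hW1⟩
  have reachA : ∀ a, ρ₀ (Sum.inr a) (Sum.inl 0) → ∃ z, ρ (Sum.inl a) z ∧ updWall m 1 P₁ z := fun a h =>
    ⟨Sum.inl a, EqvGen.refl _, flagA a h⟩
  refine lump_patternOf_absorb (g' := updRel m P₁' E₁') hE (fun x y h => ?_) (fun x y => Iff.rfl)
    (fun x y h => ?_) (fun z hz => ?_) (fun z hz => ?_)
  · -- `ρ ≤ ρ'`
    refine eqvGen_le_eqvGen (fun x y h => EqvGen.rel _ _ ?_) x y h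
    rcases x with a | b <;> rcases y with a' | b' <;> simp only [updRel] at h ⊢
    · rw [hrel'] ; rw [hrel] at h; exact Or.inl h
    · exact h
    · exact h
  · -- generators of `ρ'`
    rcases x with a | b <;> rcases y with a' | b' <;> simp only [updRel] at h
    · rw [hrel'] at h
      rcases h with h | ⟨h1, h2⟩ | ⟨h1, h2⟩
      · exact Or.inl (EqvGen.rel (Sum.inl a) (Sum.inl a') ((hrel a a').2 h))
      · exact Or.inr ⟨reachA a h1, reachB a' h2⟩
      · exact Or.inr ⟨reachB a (hE0.symm h1), reachA a' (hE0.symm h2)⟩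
    · exact Or.inl (EqvGen.rel (Sum.inl a) (Sum.inr b') h)
    · exact Or.inl (EqvGen.rel (Sum.inr b) (Sum.inl a') h)
  · -- `W ≤ W'`
    rcases z with a | b
    · simp only [updWall] at hz ⊢
      rw [hflag] at hz; rw [hflag']
      obtain ⟨z, h1, h2⟩ := hz
      exact ⟨z, Or.inl h1, h2⟩
    · exact hz
  · -- extra wall contacts are reachable
    rcases z with a | b
    · simp only [updWall] at hz ⊢
      rw [hflag'] at hz
      obtain ⟨z, h1 | ⟨h1, -⟩ | ⟨h1, -⟩, h2⟩ := hz
      · exact Or.inl ((hflag a).2 ⟨z, h1, h2⟩)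
      · exact Or.inl (flagA a h1)
      · exact Or.inr (reachB a (hE0.symm h1))
    · exact Or.inl hz

end Bottom

section BottomReflect

variable {K : Type*} [Field K]

/-- **The two-layer kernel only sees `(1-p₀(e))(1-p₁(e'))` of the two bottom edges** (`e`, `e'` the
edges of top level `1` of the two layers, both ending at the wall): for an input flagged at the wall
site. This is the mechanism of the reflection `z_1 → 1/z_1` of Ikhlef–Ponsaing's Lemma 3.2.
[cite: IkhlefPonsaing2012, Lemma 3.2] -/
theorem ipTwoLayerW_bottom_congr {p₀ p₁ p₀' p₁' : Sym2 (Site 2) → K}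
    (h₀ : ∀ e ∈ latticeLayer m 0, e ≠ s(colSite 0 ((0 : Fin (m + 1)) : ℕ), colSite (0 + 1) ((0 : Fin (m + 1)) : ℕ)) →
      p₀' e = p₀ e)
    (h₁ : ∀ e ∈ latticeLayer m 1, e ≠ s(colSite 1 ((0 : Fin (m + 1)) : ℕ), colSite (1 + 1) ((0 : Fin (m + 1)) : ℕ)) →
      p₁' e = p₁ e)
    (hprod : (1 - p₀' s(colSite 0 ((0 : Fin (m + 1)) : ℕ), colSite (0 + 1) ((0 : Fin (m + 1)) : ℕ))) *
        (1 - p₁' s(colSite 1 ((0 : Fin (m + 1)) : ℕ), colSite (1 + 1) ((0 : Fin (m + 1)) : ℕ))) =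
      (1 - p₀ s(colSite 0 ((0 : Fin (m + 1)) : ℕ), colSite (0 + 1) ((0 : Fin (m + 1)) : ℕ))) *
        (1 - p₁ s(colSite 1 ((0 : Fin (m + 1)) : ℕ), colSite (1 + 1) ((0 : Fin (m + 1)) : ℕ))))
    {Q : ColPattern m} (hQ0 : Q.2 0 = true) (Q' : ColPattern m) :
    ipTwoLayerW m p₀ p₁ Q Q' = ipTwoLayerW m p₀' p₁' Q Q' := by
  set o : Fin (m + 1) := 0 with ho
  set e₀ := s(colSite 0 (o : ℕ), colSite (0 + 1) (o : ℕ)) with he₀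
  set e₁ := s(colSite 1 (o : ℕ), colSite (1 + 1) (o : ℕ)) with he₁
  have he₀mem : e₀ ∈ latticeLayer m 0 := (mk_mem_latticeLayer_iff 0 o o).2 (Or.inl rfl)
  have he₁mem : e₁ ∈ latticeLayer m 1 := (mk_mem_latticeLayer_iff 1 o o).2 (Or.inl rfl)
  rw [ipTwoLayerW_eq_sum_sum, ipTwoLayerW_eq_sum_sum,
    sum_powerset_edge_decomp he₀mem p₀, sum_powerset_edge_decomp he₀mem p₀']
  refine Finset.sum_congr rfl fun t₀ ht₀ => ?_
  have ht₀s : t₀ ⊆ (latticeLayer m 0).erase e₀ := Finset.mem_powerset.1 ht₀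
  have hw₀ : ((∏ e ∈ t₀, p₀' e) * ∏ e ∈ (latticeLayer m 0).erase e₀ \ t₀, (1 - p₀' e)) =
      (∏ e ∈ t₀, p₀ e) * ∏ e ∈ (latticeLayer m 0).erase e₀ \ t₀, (1 - p₀ e) := by
    have h1 : ∏ e ∈ t₀, p₀' e = ∏ e ∈ t₀, p₀ e := Finset.prod_congr rfl fun e he =>
      h₀ e (Finset.mem_of_mem_erase (ht₀s he)) (Finset.mem_erase.1 (ht₀s he)).1
    have h2 : ∏ e ∈ (latticeLayer m 0).erase e₀ \ t₀, (1 - p₀' e) =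
        ∏ e ∈ (latticeLayer m 0).erase e₀ \ t₀, (1 - p₀ e) := Finset.prod_congr rfl fun e he => by
      rw [h₀ e (Finset.mem_of_mem_erase (Finset.sdiff_subset he)) (Finset.mem_erase.1 (Finset.sdiff_subset he)).1]
    rw [h1, h2]
  rw [hw₀]
  rw [sum_powerset_edge_decomp he₁mem p₁, sum_powerset_edge_decomp he₁mem p₁,
    sum_powerset_edge_decomp he₁mem p₁', sum_powerset_edge_decomp he₁mem p₁']
  rw [Finset.sum_mul, Finset.sum_mul, Finset.sum_mul, Finset.sum_mul, ← Finset.sum_add_distrib,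
    ← Finset.sum_add_distrib, Finset.mul_sum, Finset.mul_sum]
  refine Finset.sum_congr rfl fun t₁ ht₁ => ?_
  have ht₁s : t₁ ⊆ (latticeLayer m 1).erase e₁ := Finset.mem_powerset.1 ht₁
  have hw₁ : ((∏ e ∈ t₁, p₁' e) * ∏ e ∈ (latticeLayer m 1).erase e₁ \ t₁, (1 - p₁' e)) =
      (∏ e ∈ t₁, p₁ e) * ∏ e ∈ (latticeLayer m 1).erase e₁ \ t₁, (1 - p₁ e) := by
    have h1 : ∏ e ∈ t₁, p₁' e = ∏ e ∈ t₁, p₁ e := Finset.prod_congr rfl fun e he =>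
      h₁ e (Finset.mem_of_mem_erase (ht₁s he)) (Finset.mem_erase.1 (ht₁s he)).1
    have h2 : ∏ e ∈ (latticeLayer m 1).erase e₁ \ t₁, (1 - p₁' e) =
        ∏ e ∈ (latticeLayer m 1).erase e₁ \ t₁, (1 - p₁ e) := Finset.prod_congr rfl fun e he => by
      rw [h₁ e (Finset.mem_of_mem_erase (Finset.sdiff_subset he)) (Finset.mem_erase.1 (Finset.sdiff_subset he)).1]
    rw [h1, h2]
  rw [hw₁]
  -- the three wall-attached configurations give the same lumped pattern
  have hins₀ : edgeFn m 0 (insert e₀ t₀) = setEdge (edgeFn m 0 t₀) o o true := by rw [he₀, edgeFn_insert]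
  have hins₁ : edgeFn m 1 (insert e₁ t₁) = setEdge (edgeFn m 1 t₁) o o true := by rw [he₁, edgeFn_insert]
  have hflag1 : (colUpdate m 0 Q (setEdge (edgeFn m 0 t₀) o o true)).2 o = true := by
    classical
    simp only [colUpdate, decide_eq_true_eq]
    exact ⟨Sum.inl o, EqvGen.symm _ _ (EqvGen.rel (Sum.inl o) (Sum.inr o) (setEdge_same _ o o true)), hQ0⟩
  have G1 : lump (colUpdate m 1 (colUpdate m 0 Q (edgeFn m 0 (insert e₀ t₀))) (edgeFn m 1 (insert e₁ t₁))) =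
      lump (colUpdate m 1 (colUpdate m 0 Q (edgeFn m 0 (insert e₀ t₀))) (edgeFn m 1 t₁)) := by
    rw [hins₀, hins₁]
    exact lump_colUpdate_setEdge_of_flag hflag1 ⟨by norm_num, rfl⟩
  have G2 : lump (colUpdate m 1 (colUpdate m 0 Q (edgeFn m 0 (insert e₀ t₀))) (edgeFn m 1 (insert e₁ t₁))) =
      lump (colUpdate m 1 (colUpdate m 0 Q (edgeFn m 0 t₀)) (edgeFn m 1 (insert e₁ t₁))) := by
    rw [hins₀, hins₁]
    exact lump_colUpdate_colUpdate_setEdge_bottom hQ0 _ (setEdge_same _ o o true)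
  rw [← G1, G2]
  linear_combination ((∏ e ∈ t₀, p₀ e) * ∏ e ∈ (latticeLayer m 0).erase e₀ \ t₀, (1 - p₀ e)) *
    ((∏ e ∈ t₁, p₁ e) * ∏ e ∈ (latticeLayer m 1).erase e₁ \ t₁, (1 - p₁ e)) *
    ((if lump (colUpdate m 1 (colUpdate m 0 Q (edgeFn m 0 t₀)) (edgeFn m 1 (insert e₁ t₁))) = Q'
        then (1 : K) else 0) -
      (if lump (colUpdate m 1 (colUpdate m 0 Q (edgeFn m 0 t₀)) (edgeFn m 1 t₁)) = Q' then (1 : K) else 0)) * hprod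

/-- **Ikhlef–Ponsaing's Lemma 3.2, bottom reflection: `t(w; 1/z_1, z_2, …) = t(w; z_1, z_2, …)`** in
the cluster language (input flagged at the wall site, e.g. any valid even pattern). [cite: IkhlefPonsaing2012, Lemma 3.2] -/
theorem ipTransferMatrixW_reflect_bottom (q w : K) (z : ℕ → K) {Q : ColPattern m} (hQ0 : Q.2 0 = true)
    (Q' : ColPattern m) :
    ipTransferMatrixW m q w (Function.update z 1 (z 1)⁻¹) Q Q' = ipTransferMatrixW m q w z Q Q' := by
  rw [ipTransferMatrixW_eq, ipTransferMatrixW_eq]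
  symm
  have hlev₀ : (edgeTopLevel s(colSite 0 ((0 : Fin (m + 1)) : ℕ), colSite (0 + 1) ((0 : Fin (m + 1)) : ℕ))).toNat = 1 := by
    rw [edgeTopLevel_mk_colSite]; simp
  have hlev₁ : (edgeTopLevel s(colSite 1 ((0 : Fin (m + 1)) : ℕ), colSite (1 + 1) ((0 : Fin (m + 1)) : ℕ))).toNat = 1 := by
    rw [edgeTopLevel_mk_colSite]; simp
  have hmem₀ : s(colSite 0 ((0 : Fin (m + 1)) : ℕ), colSite (0 + 1) ((0 : Fin (m + 1)) : ℕ)) ∈ latticeLayer m 0 :=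
    (mk_mem_latticeLayer_iff 0 _ _).2 (Or.inl rfl)
  have hmem₁ : s(colSite 1 ((0 : Fin (m + 1)) : ℕ), colSite (1 + 1) ((0 : Fin (m + 1)) : ℕ)) ∈ latticeLayer m 1 :=
    (mk_mem_latticeLayer_iff 1 _ _).2 (Or.inl rfl)
  refine ipTwoLayerW_bottom_congr (fun e he hne => ?_) (fun e he hne => ?_) ?_ hQ0 Q'
  · refine ipRowWeight_congr_level q w 0 (Function.update_of_ne (fun h => hne ?_) _ _)
    exact eq_of_edgeTopLevel_eq he hmem₀ (by omega)
  · refine ipRowWeight_congr_level q w 1 (Function.update_of_ne (fun h => hne ?_) _ _)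
    exact eq_of_edgeTopLevel_eq he hmem₁ (by omega)
  · rw [ipRowWeight_eq_of_level q w _ 0 hlev₀, ipRowWeight_eq_of_level q w _ 1 hlev₁,
      ipRowWeight_eq_of_level q w _ 0 hlev₀, ipRowWeight_eq_of_level q w _ 1 hlev₁]
    have h10 : (1 : Fin 2) ≠ 0 := by decide
    simp only [Nat.one_mod, if_true, h10, if_false, Function.update_self]
    have e1 : (z 1)⁻¹ / w = (w * z 1)⁻¹ := by rw [div_eq_mul_inv, mul_inv, mul_comm]
    have e2 : (w * (z 1)⁻¹)⁻¹ = z 1 / w := by rw [mul_inv, inv_inv, div_eq_mul_inv, mul_comm]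
    rw [e1, e2, mul_comm]

end BottomReflect

end Literature.Probability.Percolation
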